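import Summits.ResolutionOfSingularities.ResolutionOfSingularities.Theorems.FrobeniusLadderFRationalResolutionSingBlowupOffFinset
import Summits.ResolutionOfSingularities.ResolutionOfSingularities.Theorems.FrobeniusLadderFRationalResolutionSingBlowupAtlas
import HarnessLib

/-!
# Crux `FrobeniusLadder.FRationalResolution` (stmt-ResolutionOfSingularities-15317), line `redirect`,
# stub `stub_diagonalizableQuotientResolution` — **A FINITE ÉTALE ATLAS OF SHARP RANK-TWO LOG REGULAR CHARTS AWAY FROM
# FINITELY MANY LOCALLY RESOLVED SINGULAR POINTS RESOLVES `X`** (user-facing form of `…SingBlowupOffFinset`: the chart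
# data in the currency of `…SingBlowupAtlas`, the exceptional points in the `hloc` currency of `…IsolatedGlue`)

**`hasResolution_of_finite_rank_two_atlas_off_finset`.** `X` integral, locally of finite type and quasi-compact over ANY
field `k`; `S` a finite set of closed singular points, each with an open `V ∋ s` meeting `Sing X` only in `s` and a proper
`ρ : Y → V`, `Y` regular, an isomorphism over `V ∩ Reg X` with dense preimage; finitely many Noetherian rings `A i` with
fs charts `φ i : P i → A i`, `P i ⊆ ℤ²` sharp, Kato-log-regular at every prime; every singular point NOT in `S` has an
étale roof `X ←ρ— Y —j↪ Spec (A i)` through it landing at a prime containing all non-trivial monomials. THEN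
`Scheme.HasResolution X`: the normal form of each chart monoid (`…ConeNormalForm.exists_normalForm`, unit face `0` by
`…ConeChartEntry.span_faceMonoid_eq_bot`, as in `…SingBlowupAtlas`) turns the atlas into the hypothesis `H` of
`…SingBlowupOffFinset.hasResolution_of_rank_two_charts_off_finset`.
Example: `X` whose singular locus is a union of curves / strata along which `X` is étale-locally
`(2-dimensional toric cone) × 𝔸^m`, plus finitely many further closed singular points at which a local resolution is
known (e.g. isolated diagonalizable quotient points, `…IsolatedQuotientResolution`), over any field.

Honest label: assembly toward ONE leaf stub (no stub, crux or summit closed); singular points of sharp rank `≥ 3` on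
positive-dimensional singular strata remain. No definitions, no named facts, no sorry.
[cite: Kato1994, Def. (2.1), (7.3), (10.1), (10.3), (10.4)] [cite: KempfEtAl1973, Ch. I §1–§2] [cite: Fulton1993Toric, §2.2, §2.6]
-/

noncomputable section

-- single-problem summit: the doubled namespace component is forced
set_option linter.dupNamespace false

open CategoryTheory CategoryTheory.Limits AlgebraicGeometry TopologicalSpace
open IsLocalRing Literature.AlgebraicGeometry.Resolution Literature.AlgebraicGeometry.Resolution.LogChart
open Summit.ResolutionOfSingularities.ResolutionOfSingularities.Theorems.FRationalResolution

namespace Summit.ResolutionOfSingularities.ResolutionOfSingularities.Theorems.FRationalResolution.SingBlowupAtlasOffFinset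

set_option maxHeartbeats 800000 in
/-- **A finite étale atlas of sharp rank-two log regular charts away from finitely many locally resolved closed singular
points resolves `X`.** See the module docstring. [cite: Kato1994, Def. (2.1), (7.3), (10.1), (10.3), (10.4)]
[cite: KempfEtAl1973, Ch. I §1–§2] -/
theorem hasResolution_of_finite_rank_two_atlas_off_finset {k : Type} [Field k] (X : Scheme.{0}) [IsIntegral X]
    (f : X ⟶ Spec (.of k)) [LocallyOfFiniteType f] [QuasiCompact f] (S : Finset X)
    (hSc : ∀ s ∈ S, IsClosed ({s} : Set X)) (hS : ∀ s ∈ S, s ∉ Scheme.regularLocus X)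
    (hloc : ∀ s ∈ S, ∃ (V : X.Opens), s ∈ V ∧
      (∀ t : X, t ∉ Scheme.regularLocus X → t ∈ V → t = s) ∧
      ∃ (Y : Scheme.{0}) (ρ : Y ⟶ V), IsProper ρ ∧ Scheme.IsRegular Y ∧
        IsIso (ρ ∣_ (V.ι ⁻¹ᵁ ⟨Scheme.regularLocus X, isOpen_regularLocus_of_locallyOfFiniteType_field f⟩)) ∧
        Dense ((ρ ⁻¹ᵁ (V.ι ⁻¹ᵁ ⟨Scheme.regularLocus X,
          isOpen_regularLocus_of_locallyOfFiniteType_field f⟩) : Y.Opens) : Set Y))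
    {ι : Type} [Finite ι] (A : ι → Type) [∀ i, CommRing (A i)] [∀ i, IsNoetherianRing (A i)]
    (P : ι → AddSubmonoid (Fin 2 → ℤ)) (φ : ∀ i, Multiplicative (P i) →* A i) (hP : ∀ i, (P i).FG)
    (hsat : ∀ i, ∀ (w : Fin 2 → ℤ) (k : ℕ), 0 < k → k • w ∈ P i → w ∈ P i)
    (hspanP : ∀ i, Submodule.span ℤ (P i : Set (Fin 2 → ℤ)) = ⊤)
    (hsharp : ∀ i, ∀ p ∈ P i, -p ∈ P i → p = 0)
    (hreg : ∀ i, ∀ (𝔮 : Ideal (A i)) [𝔮.IsPrime], IsLogRegularAt (P i) (φ i) 𝔮)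
    (H : ∀ x : X, x ∉ Scheme.regularLocus X → x ∉ S →
      ∃ (i : ι) (Y : Scheme.{0}) (ρ : Y ⟶ X) (_ : Etale ρ) (j : Y ⟶ Spec (.of (A i))) (_ : IsOpenImmersion j)
        (y : Y), ρ y = x ∧ ∀ p : P i, (p : Fin 2 → ℤ) ≠ 0 → φ i (Multiplicative.ofAdd p) ∈ (j y).asIdeal) :
    Scheme.HasResolution X := by
  classical
  -- the normal form of each chart monoid
  choose u e d a had hind hspan hmem using
    fun i => ConeNormalForm.exists_normalForm (P i) (hP i) (hsat i) (hspanP i) (hsharp i)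
  refine SingBlowupOffFinset.hasResolution_of_rank_two_charts_off_finset X f S hSc hS hloc fun x hx hxS => ?_
  obtain ⟨i, Y, ρ, _, j, _, y, hρy, hface⟩ := H x hx hxS
  have hL := ConeChartEntry.span_faceMonoid_eq_bot (P := P i) (φ := φ i) (𝔭 := (j y).asIdeal) hface
  refine ⟨A i, inferInstance, inferInstance, P i, φ i, (j y).asIdeal, inferInstance, u i, e i, a i, d i, had i,
    hP i, hsat i, hspanP i, hface, fun w => ?_, fun g hg m l h => ?_,
    fun w => ?_, Y, ρ, inferInstance, j, inferInstance, y, hρy, rfl, fun y' 𝔮 _ _ => hreg i 𝔮⟩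
  · rw [hmem i w]
    constructor
    · rintro ⟨m, l, hl, hml, rfl⟩
      exact ⟨0, Submodule.zero_mem _, m, l, hl, hml, by rw [zero_add]⟩
    · rintro ⟨g, hg, m, l, hl, hml, rfl⟩
      exact ⟨m, l, hl, hml, by rw [hL g hg, zero_add]⟩
  · rw [hL g hg, zero_add] at h
    exact hind i m l h
  · obtain ⟨m, l, rfl⟩ := hspan i w
    exact ⟨0, Submodule.zero_mem _, m, l, by rw [zero_add]⟩

end Summit.ResolutionOfSingularities.ResolutionOfSingularities.Theorems.FRationalResolution.SingBlowupAtlasOffFinset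

end
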